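import Summits.HubbardSuperconductivity.HubbardSuperconductivity.Theorems.WidthHaldaneTubeKinematics

/-!
# Stub `stub_labellingInvariance` of the line `birth` for the crux `WidthUniformThermodynamics`
# (stmt-HubbardSuperconductivity-16312, route `WidthHaldane`)

The registered stub (T) "the tube sector energy `E L M Λ e U θ N` does not depend on the labelling",
proved verbatim from `tubeEnergy_relabel` (`Theorems/WidthHaldaneTubeKinematics.lean`): the
let-prefix of the route decl ζ-reduces to `tubeEnergy` (`Theorems/WidthHaldaneDefs.lean`, every def
the corresponding let-body). No definitions, no named facts.
-/

noncomputable section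

namespace Summit.HubbardSuperconductivity.HubbardSuperconductivity.Theorems.WidthUniformThermodynamics

set_option linter.dupNamespace false -- summit = problem name (single-conjunct summit), D-0017

open scoped BigOperators Classical Matrix
open Summit.HubbardSuperconductivity.HubbardSuperconductivity.Theorems.WidthHaldane

/-- **stub (T) — LABELLING INVARIANCE** of the registered skeleton of `WidthUniformThermodynamics`:
for any two linearly ordered labellings `e : Λ ≃ ℤ/L × ℤ/M`, `e' : Λ' ≃ ℤ/L × ℤ/M` the twisted sector
energies coincide, `E L M Λ e U θ N = E L M Λ' e' U θ N` (signed-permutation transport of the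
sector `(N, S^z = 0)`; Bratteli–Robinson II §5.2.2). Verbatim the registered signature.
[cite: BratteliRobinsonII1997, §5.2.2, Thm. 5.2.5] -/
theorem stub_labellingInvariance :
    open Matrix Literature.MathematicalPhysics.QuantumLattice in let H0 : ∀ (L M : ℕ) (Λ : Type) [LinearOrder Λ] [Fintype Λ], (Λ ≃ ZMod L × ZMod M) → ℝ → Matrix (Finset (Orb Λ)) (Finset (Orb Λ)) ℂ := fun _ _ Λ _ _ e U => hamiltonian (SimpleGraph.fromRel fun x y : Λ => y = e.symm ((e x).1 + 1, (e x).2) ∨ y = e.symm ((e x).1, (e x).2 + 1)) 1 U; let Tw : ∀ (L M : ℕ) [NeZero L] [NeZero M] (Λ : Type) [LinearOrder Λ] [Fintype Λ], (Λ ≃ ZMod L × ZMod M) → ℝ → Matrix (Finset (Orb Λ)) (Finset (Orb Λ)) ℂ := fun _ M _ _ _ _ _ e θ => ∑ b : ZMod M, ∑ σ : Fin 2, ((1 - Complex.exp (Complex.I * θ)) • (creation (orb (e.symm (0, b)) σ) * annihilation (orb (e.symm (-1, b)) σ)) + (1 - Complex.exp (-(Complex.I * θ))) • (creation (orb (e.symm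 (-1, b)) σ) * annihilation (orb (e.symm (0, b)) σ))); let E : ∀ (L M : ℕ) [NeZero L] [NeZero M] (Λ : Type) [LinearOrder Λ] [Fintype Λ], (Λ ≃ ZMod L × ZMod M) → ℝ → ℝ → ℕ → ℝ := fun L M _ _ Λ _ _ e U θ N => (H0 L M Λ e U + Tw L M Λ e θ).minEnergyOn (szSector N 0); ∀ (L M : ℕ) [NeZero L] [NeZero M] (Λ : Type) [LinearOrder Λ] [Fintype Λ] (Λ' : Type) [LinearOrder Λ'] [Fintype Λ'] (e : Λ ≃ ZMod L × ZMod M) (e' : Λ' ≃ ZMod L × ZMod M) (U θ : ℝ) (N : ℕ), E L M Λ e U θ N = E L M Λ' e' U θ N := by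
  dsimp only
  intro L M _ _ Λ _ _ Λ' _ _ e e' U θ N
  exact tubeEnergy_relabel L M Λ e Λ' e' U θ N

end Summit.HubbardSuperconductivity.HubbardSuperconductivity.Theorems.WidthUniformThermodynamics

end
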